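import Mathlib
import HarnessLib
import Summits.Ventures.LatticeQCDFlow.Exactness.TransformedKernel
import Summits.Ventures.LatticeQCDFlow.Exactness.KickAngleMap
import Summits.Ventures.LatticeQCDFlow.Exactness.KickAngleJacobian

/-!
# The polar model of THMC, solved: the kick as a measurable bijection with its printed Jacobian makes the field-transformed update exact, and its first-order modified action shows the trivializing choice `κ = a/(m+1)`

HONEST FRAMING: exact (Metropolis-corrected) sampling algorithms for lattice gauge theory;
figures of merit are autocorrelation/cost numbers at stated couplings and volumes; no
continuum-physics claim.

Venture `LatticeQCDFlow` (cell pub-lqcd), topic `Exactness`; FANOUT row 7 (`s0-cpn-null`: the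
S0-D1 rung — 2D CP⁹, Lüscher's leading-order trivializing map inside HMC, Engel–Schaefer 2011).
NEW WORK of the cell, assembling the tree's own files: `Exactness/KickAngleMap.lean` (`kickAngle κ`,
strictly increasing and surjective for `|κ| ≤ 1`), `Exactness/KickAngleJacobian.lean` (`polarLaw m`,
`kickJac κ m` = E–S eq. (18), `hasJacobian_kickAngle`, `hasDerivAt_kickJac_zero`) and
`Exactness/TransformedKernel.lean` (`conjKernel`, `transformedUpdate_invariant/_isReversible`).
Nothing is cited as a fact.  Printed counterparts, NAMED ONLY: Engel–Schaefer 2011 §3 (the LO map,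
its Jacobian (18), `S_eff = S(F(y)) − Σ ln det 𝒥`); Lüscher 2010 §3 (leading-order trivializing
maps: the `O(t)` term of `S∘𝓕_t − ln det 𝓕_{t*}`).

## The polar model

One site, its local field `J` fixed, everything read in the polar angle `θ` from `Ĵ`: reference
law `polarLaw m = sin^m θ dθ|_{[0,π]}` (`m = 2N − 2`), target weight `e^{−S(θ)}` on it (for the
CP(N−1) auxiliary-field action the single-site conditional weight is `e^{a cos θ}`, `a ∝ β‖J‖`:
von Mises–Fisher in polar form — we keep `S` general), field transformation `θ = kickAngle κ θ'`.
This is THMC's one-site, one-step shadow, and here everything is in closed form.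

## Content

* `kickEquiv hκ : ℝ ≃ᵐ ℝ` (`|κ| ≤ 1`) — the kick as a measurable bijection of `ℝ` (strictly
  increasing continuous surjection; `coe_kickEquiv`).
* **`thmc_polar_exact`** — for `|κ| ≤ 1`, every measurable `S`, and EVERY update `K` of the
  `θ'`-variable leaving the pulled-back weight `(e^{−S} ∘ kickAngle κ) · kickJac κ m · polarLaw m`
  invariant (`= e^{−S_eff} · polarLaw m` with `S_eff = S ∘ kickAngle κ − log kickJac κ m` on
  `(0, π)`, where `kickJac > 0` for `|κ| < 1`): the update REPORTED through the kick,
  `conjKernel K (kickEquiv hκ)`, leaves `e^{−S} · polarLaw m` invariant — THMC exactness with an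
  honestly computed Jacobian, no hypothesis left; `thmc_polar_isReversible` — detailed balance
  transfers too.
* **`hasDerivAt_polarEffAction_zero`** — for the von Mises–Fisher weight `S(θ) = −a cos θ`:
  `d/dκ|₀ [S(kickAngle κ θ) − log kickJac κ m θ] = −a sin²θ + (m + 1) cos θ` on `(0, π)` (chain rule
  + `hasDerivAt_kickJac_zero`); `firstOrder_polarEffAction` — so to first order in `κ` the
  effective action is `−(a − (m+1)κ) cos θ − κ a sin²θ` (+ const); **`firstOrder_trivializing`** —
  the choice `κ = a/(m+1)` removes the `O(a)` angular dependence, leaving `−(a²/(m+1)) sin²θ`: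
  the single-site law is trivialized AT LEADING ORDER IN `a` (i.e. in `β`) exactly when the kick
  strength is the action strength divided by the SPHERE DIMENSION `m + 1 = 2N − 1` — the
  denominator `2N − 1` of E–S's map constant is the Jacobian's leading term (`KickAngleJacobian`).

NOT CLAIMED: the lattice-wide LO generator (E–S eq. (15): both endpoints of a link move, giving
`2(2N−1)`), anything about which printed constant is "right" (that was settled by the cell's
census, CANARY-C8 §4, not by this lemma), higher orders, autocorrelations; the identification of
the single-site conditional law with `e^{a cos θ} · polarLaw (2N−2)` (the axis disintegration of
the sphere measure is not in the tree).
-/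

noncomputable section

namespace Summit.Ventures.LatticeQCDFlow.Exactness

open Real Set MeasureTheory ProbabilityTheory ProbabilityTheory.Kernel
open scoped ENNReal

/-! ## The kick as a measurable bijection of `ℝ` -/

/-- For `|κ| ≤ 1` the kick `θ ↦ θ − κ sin θ` as an order isomorphism of `ℝ` (strictly increasing
and surjective). -/
def kickOrderIso {κ : ℝ} (hκ : |κ| ≤ 1) : ℝ ≃o ℝ :=
  StrictMono.orderIsoOfSurjective (kickAngle κ) (strictMono_kickAngle hκ) (surjective_kickAngle κ)

/-- … hence as a measurable bijection of `ℝ` (via the order topology: a homeomorphism). -/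
def kickEquiv {κ : ℝ} (hκ : |κ| ≤ 1) : ℝ ≃ᵐ ℝ :=
  (kickOrderIso hκ).toHomeomorph.toMeasurableEquiv

/-- The underlying map of `kickEquiv` is `kickAngle κ`. -/
@[simp] theorem coe_kickEquiv {κ : ℝ} (hκ : |κ| ≤ 1) : ⇑(kickEquiv hκ) = kickAngle κ := by
  rw [kickEquiv, Homeomorph.toMeasurableEquiv_coe, OrderIso.coe_toHomeomorph, kickOrderIso,
    StrictMono.coe_orderIsoOfSurjective]

/-- `kickEquiv` has the printed Jacobian against the polar law (`KickAngleJacobian.hasJacobian_kickAngle`,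
restated for the bundled map). -/
theorem hasJacobian_kickEquiv {κ : ℝ} (hκ : |κ| ≤ 1) (m : ℕ) :
    HasJacobian (polarLaw m) (kickEquiv hκ) fun θ => ENNReal.ofReal (kickJac κ m θ) := by
  rw [coe_kickEquiv]
  exact hasJacobian_kickAngle hκ m

/-! ## THMC in the polar model is exact — with the Jacobian computed, not assumed -/

/-- **THMC in the polar model is exact.**  `|κ| ≤ 1`, `S` measurable.  If an update `K` of the
pre-image variable `θ'` leaves the pulled-back weight
`(e^{−S} ∘ kickAngle κ) · kickJac κ m · polarLaw m` invariant (HMC for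
`S_eff = S ∘ kickAngle κ − log kickJac κ m`, Metropolis, heat bath — anything exact for it), then
`K` reported through the kick leaves `e^{−S} · polarLaw m` invariant. -/
theorem thmc_polar_exact {κ : ℝ} (hκ : |κ| ≤ 1) (m : ℕ) {S : ℝ → ℝ} (hS : Measurable S)
    {K : Kernel ℝ ℝ}
    (hK : Invariant K ((polarLaw m).withDensity fun θ =>
      ENNReal.ofReal (Real.exp (-S (kickAngle κ θ))) * ENNReal.ofReal (kickJac κ m θ))) :
    Invariant (conjKernel K (kickEquiv hκ))
      ((polarLaw m).withDensity fun θ => ENNReal.ofReal (Real.exp (-S θ))) := by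
  have h := transformedUpdate_invariant (hasJacobian_kickEquiv hκ m)
    (p := fun θ => ENNReal.ofReal (Real.exp (-S θ)))
    (ENNReal.measurable_ofReal.comp (Real.measurable_exp.comp hS.neg)) (κ := K)
  rw [coe_kickEquiv] at h
  exact h hK

/-- … and detailed balance transfers the same way. -/
theorem thmc_polar_isReversible {κ : ℝ} (hκ : |κ| ≤ 1) (m : ℕ) {S : ℝ → ℝ} (hS : Measurable S)
    {K : Kernel ℝ ℝ}
    (hK : IsReversible K ((polarLaw m).withDensity fun θ =>
      ENNReal.ofReal (Real.exp (-S (kickAngle κ θ))) * ENNReal.ofReal (kickJac κ m θ))) :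
    IsReversible (conjKernel K (kickEquiv hκ))
      ((polarLaw m).withDensity fun θ => ENNReal.ofReal (Real.exp (-S θ))) := by
  have h := transformedUpdate_isReversible (hasJacobian_kickEquiv hκ m)
    (p := fun θ => ENNReal.ofReal (Real.exp (-S θ)))
    (ENNReal.measurable_ofReal.comp (Real.measurable_exp.comp hS.neg)) (κ := K)
  rw [coe_kickEquiv] at h
  exact h hK

/-- On `(0, π)` and for `|κ| < 1` the pulled-back weight IS a Boltzmann weight:
`e^{−S(kickAngle κ θ)} · kickJac κ m θ = e^{−S_eff(θ)}`, `S_eff = S ∘ kickAngle κ − log kickJac κ m`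
(`TransformedKernel.exp_neg_transformedAction` with `kickJac > 0`). -/
theorem polar_pulledBack_weight {κ : ℝ} (hκ : |κ| < 1) (m : ℕ) (S : ℝ → ℝ) {θ : ℝ}
    (hθ : θ ∈ Ioo 0 π) :
    Real.exp (-S (kickAngle κ θ)) * kickJac κ m θ =
      Real.exp (-(S (kickAngle κ θ) - Real.log (kickJac κ m θ))) :=
  (exp_neg_transformedAction (S := S) (F := kickAngle κ) (J := kickJac κ m)
    (kickJac_pos hκ m hθ)).symm

/-! ## First order in `κ`: the effective action and the trivializing choice -/

/-- **The effective action to first order in the kick strength.**  For the von Mises–Fisher site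
weight `S(θ) = −a cos θ` and `θ ∈ (0, π)`:
`d/dκ|₀ [S(kickAngle κ θ) − log kickJac κ m θ] = −a sin²θ + (m + 1) cos θ`
— the action's own first-order change plus the Jacobian's leading term (minus the divergence of
the kick field: `(m+1) cos θ`, `KickAngleJacobian.hasDerivAt_kickJac_zero`). -/
theorem hasDerivAt_polarEffAction_zero (a : ℝ) (m : ℕ) {θ : ℝ} (hθ : θ ∈ Ioo 0 π) :
    HasDerivAt (fun κ => -a * cos (kickAngle κ θ) - Real.log (kickJac κ m θ))
      (-a * sin θ ^ 2 + ((m : ℝ) + 1) * cos θ) 0 := by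
  -- the action part
  have ha : HasDerivAt (fun κ : ℝ => kickAngle κ θ) (-(1 * sin θ)) 0 :=
    ((hasDerivAt_id' (0 : ℝ)).mul_const (sin θ)).const_sub θ
  have h1 : HasDerivAt (fun κ : ℝ => -a * cos (kickAngle κ θ))
      (-a * (-sin (kickAngle 0 θ) * -(1 * sin θ))) 0 := (ha.cos).const_mul (-a)
  -- the Jacobian part: `log ∘ kickJac`, `kickJac 0 = 1`
  have hJ0 : kickJac 0 m θ = 1 := kickJac_zero_left m hθ
  have h2 : HasDerivAt (fun κ : ℝ => Real.log (kickJac κ m θ))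
      ((-((m : ℝ) + 1) * cos θ) / kickJac 0 m θ) 0 :=
    (hasDerivAt_kickJac_zero m hθ).log (by rw [hJ0]; exact one_ne_zero)
  have h := h1.sub h2
  refine h.congr_deriv ?_
  rw [hJ0, kickAngle_zero_left]
  ring

/-- The first-order effective action, rearranged by harmonics:
`−a cos θ + κ (−a sin²θ + (m+1) cos θ) = −(a − (m+1)κ) cos θ − κ a sin²θ`. -/
theorem firstOrder_polarEffAction (a κ θ : ℝ) (m : ℕ) :
    -a * cos θ + κ * (-a * sin θ ^ 2 + ((m : ℝ) + 1) * cos θ) =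
      -(a - ((m : ℝ) + 1) * κ) * cos θ - κ * a * sin θ ^ 2 := by
  ring

/-- **The trivializing choice.**  With `κ = a/(m + 1)` — kick strength = action strength over the
sphere dimension `m + 1 = 2N − 1` — the `O(a)` angular dependence cancels and the first-order
effective action is `−(a²/(m+1)) sin²θ`, of SECOND order in `a` (i.e. in `β`): the single-site law
is trivialized at leading order. -/
theorem firstOrder_trivializing (a θ : ℝ) (m : ℕ) :
    -a * cos θ + a / ((m : ℝ) + 1) * (-a * sin θ ^ 2 + ((m : ℝ) + 1) * cos θ) =
      -(a ^ 2 / ((m : ℝ) + 1)) * sin θ ^ 2 := by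
  have hm : ((m : ℝ) + 1) ≠ 0 := by positivity
  field_simp
  ring

/-- Conversely the cancellation forces the choice: if the `cos θ`-coefficient `a − (m+1)κ` of the
first-order effective action vanishes then `κ = a/(m+1)`. -/
theorem trivializing_iff (a κ : ℝ) (m : ℕ) :
    a - ((m : ℝ) + 1) * κ = 0 ↔ κ = a / ((m : ℝ) + 1) := by
  have hm : ((m : ℝ) + 1) ≠ 0 := by positivity
  constructor
  · intro h
    field_simp
    linarith
  · intro h
    rw [h]
    field_simp
    ring

end Summit.Ventures.LatticeQCDFlow.Exactness

end
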